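/-
Copyright (c) 2026 the pub-hodgecm-mathlib formalisation cell (harness21).  Prover seat hodgecm-mathlib-K2E1-p11 (g2), Track B ∕ K2-LIT, h413 =
`stmt-HodgeConjecture-24833`, line `K2_E1_TraceFormulaBeta`, 5Res campaign «ENDGAME BY FAMILIES» ∕ ROADCARD §3′ (M2 v2), ruling (261) (P-b): the WEYL SYMMETRY `s(z) = s(1−z)` of a
Hecke symbol acting on a family with a functional equation — the letter `hsymm : s(½−it) = s(½+it)` of the self-dual `hU` (y1-c), hypothesis-first on the functional equation as a
FUNCTION identity (abstract: any module, any action).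
-/
import Mathlib.Analysis.Analytic.Uniqueness
import Mathlib.Analysis.Complex.CauchyIntegral
import HarnessLib

/-!
# (261)(P-b) — `K2E1ChiSymbolWeylSymmetryM1CMTwo`: `s(z) = s(1 − z)` for the symbol of an operator acting by scalars on a family with a functional equation; the axis print `s(½−it) = s(½+it)`

Cell `pub/hodgecm-mathlib`, crux H413 = `stmt-HodgeConjecture-24833`, route `HCCMUnconditional`; dealer K2E1-plan (g7) ruling (261) on this seat's third (y1) finding (the self-dual model's
`M(½−it)`-term mixes `z` and `1 − z̄`, so `U R(h) = M_{s} U` on a self-dual block needs `s(½−it) = s(½+it)`).  THEOREMS ONLY (no `def` ∕ `instance` ∕ `notation` ∕ named-fact hypothesis ∕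
`sorry`); lane `--kind proof --supports stmt-HodgeConjecture-24833 --as helper` (count-neutral; closes no socket).  ABSTRACT: any `ℂ`-module of «functions» `F`, any map `T : F → F`
(the Hecke operator `R(h)`), two families `E, E′ : ℂ → F` (the continued Eisenstein family at `φ` and at the intertwined section `φ′`), scalars `q, s : ℂ → ℂ`.
THE MATHEMATICS ((G1)'s argument of ★ `K2E1SphericalTransformSymmetryU` §2 for sections; [MoeglinWaldspurger1995, IV.1.10, II.2.4]; [BernsteinLapid2019, §5]).  If on a set `O` one has the
FUNCTIONAL EQUATION `E(z) = q(z)•E′(1−z)`, the EIGEN-EQUATIONS `T(E(z)) = s(z)•E(z)` and `T(E′(1−z)) = s(1−z)•E′(1−z)` (★ P1 ∕ 12d-C: ONE symbol `s` for every section of the self-dual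
block `V(χ,K′,ω)`, transported to the continued family), `T(q•v) = q•T(v)`, and `E(z) ≠ 0`, then `s(z)•E(z) = T(E(z)) = q(z)•T(E′(1−z)) = q(z)s(1−z)•E′(1−z) = s(1−z)•E(z)`, so **`s(z) = s(1−z)`
on `O`** (§1); if `s` is entire and `O` accumulates at a point (e.g. is open non-empty), the identity holds EVERYWHERE (§2, identity theorem), in particular **`s(½−it) = s(½+it)`** (§3) —
the letter `hsymm` of (y1-c).  The M1 instantiation (rank one, `K_max`, `χ_∞ = 1`) takes the M1 functional equation «`E(z,φ) = qc(z)·E(1−z,φ′)` as functions» as the binder `hFE`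
(payer: K2E1-p13∕p14's ★ FE-χ chain — decl to be named by them per (261)).
* §1 **`symbol_eq_of_functionalEquation`**.  * §2 **`symbol_weylSymm_of_frequently`**.  * §3 **`symbol_axis_symm`**.
HONEST LABEL.  Count-neutral helper; proves no printed statement; Mathlib-only; hypothesis-first on `hFE`∕`hT`∕`hT′`.  HC_CM is proved only modulo the 7 printed citations (2 remaining named
inputs: hLiu418 = `stmt-HodgeConjecture-24832`, h413 = `stmt-HodgeConjecture-24833`) until rung 0 closes.

## References
* [MoeglinWaldspurger1995] C. Mœglin, J.-L. Waldspurger, *Spectral decomposition and Eisenstein series* (1995), IV.1.10, II.2.4.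
* [BernsteinLapid2019] J. Bernstein, E. Lapid, *On the meromorphic continuation of Eisenstein series*, J. AMS 37 (2024), §5 (functional equations from uniqueness).
-/

set_option autoImplicit false
-- the mandated namespace repeats `HodgeConjecture.HodgeConjecture`, as in every `Theorems/*.lean` of this sub-problem
set_option linter.dupNamespace false

noncomputable section

open Set Filter Topology Complex

namespace Summit.HodgeConjecture.HodgeConjecture.Cruxes.H413.K2E1ChiSymbolWeylSymmetryM1CMTwo

variable {F : Type*} [AddCommGroup F] [Module ℂ F]

/-! ## §1 The pointwise symmetry from the functional equation -/

/-- **`s(z) = s(1−z)` FROM THE FUNCTIONAL EQUATION** (one parameter `z`): `E = q•E′`, `T E = s(z)•E`, `T E′ = s(1−z)•E′`, `T` commutes with the scalar `q`, `E ≠ 0` ⟹ `s z = s (1 − z)`.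
[cite: MoeglinWaldspurger1995, IV.1.10] [cite: BernsteinLapid2019, §5] -/
theorem symbol_eq_of_functionalEquation (T : F → F) (hT : ∀ (c : ℂ) (v : F), T (c • v) = c • T v) {E E' : F} {q s₁ s₂ : ℂ}
    (hFE : E = q • E') (hTE : T E = s₁ • E) (hTE' : T E' = s₂ • E') (hne : E ≠ 0) : s₁ = s₂ := by
  have h1 : s₁ • E = s₂ • E := by
    calc s₁ • E = T E := hTE.symm
      _ = q • T E' := by rw [hFE, hT]
      _ = s₂ • E := by rw [hTE', smul_smul, mul_comm, ← smul_smul, ← hFE]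
  have h2 : (s₁ - s₂) • E = 0 := by rw [sub_smul, h1, sub_self]
  by_contra hs
  exact hne ((smul_eq_zero.1 h2).resolve_left (sub_ne_zero.2 hs))

/-! ## §2 Everywhere, by the identity theorem -/

/-- **`s(z) = s(1−z)` EVERYWHERE**: if `s` is entire and the data of §1 hold frequently near some `z₀` (e.g. on an open non-empty set — the tube where the family converges), then
`s z = s (1 − z)` for all `z` (`z ↦ s(1−z)` is entire; Mathlib `AnalyticOnNhd.eqOn_of_preconnected_of_frequently_eq` on `univ`). [cite: MoeglinWaldspurger1995, IV.1.10, II.2.4] -/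
theorem symbol_weylSymm_of_frequently {s : ℂ → ℂ} (hs : Differentiable ℂ s) {z₀ : ℂ} (h : ∃ᶠ z in 𝓝[≠] z₀, s z = s (1 - z)) (z : ℂ) :
    s z = s (1 - z) := by
  have h1 : AnalyticOnNhd ℂ s univ := hs.differentiableOn.analyticOnNhd isOpen_univ
  have h2 : AnalyticOnNhd ℂ (fun z => s (1 - z)) univ :=
    (hs.comp (differentiable_const 1 |>.sub differentiable_id)).differentiableOn.analyticOnNhd isOpen_univ
  exact AnalyticOnNhd.eqOn_of_preconnected_of_frequently_eq h1 h2 isPreconnected_univ (mem_univ z₀) h (mem_univ z)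

/-- **THE FAMILY VERSION**: families `E, E′ : ℂ → F`, scalars `q, s`; on an open non-empty `O`: the functional equation `E z = q z • E′ (1 − z)`, the eigen-equations `T (E z) = s z • E z`,
`T (E′ (1 − z)) = s (1 − z) • E′ (1 − z)`, and `E z ≠ 0`; `s` entire ⟹ `s z = s (1 − z)` for ALL `z`. [cite: MoeglinWaldspurger1995, IV.1.10, II.2.4] [cite: BernsteinLapid2019, §5] -/
theorem symbol_weylSymm (T : F → F) (hT : ∀ (c : ℂ) (v : F), T (c • v) = c • T v) (E E' : ℂ → F) (q : ℂ → ℂ) {s : ℂ → ℂ} (hs : Differentiable ℂ s)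
    {O : Set ℂ} (hO : IsOpen O) (hOne : O.Nonempty)
    (hFE : ∀ z ∈ O, E z = q z • E' (1 - z)) (hTE : ∀ z ∈ O, T (E z) = s z • E z) (hTE' : ∀ z ∈ O, T (E' (1 - z)) = s (1 - z) • E' (1 - z))
    (hne : ∀ z ∈ O, E z ≠ 0) (z : ℂ) : s z = s (1 - z) := by
  obtain ⟨z₀, hz₀⟩ := hOne
  refine symbol_weylSymm_of_frequently hs (z₀ := z₀) ?_ z
  have hev : ∀ᶠ w in 𝓝[≠] z₀, s w = s (1 - w) := by
    filter_upwards [mem_nhdsWithin_of_mem_nhds (hO.mem_nhds hz₀)] with w hw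
    exact symbol_eq_of_functionalEquation T hT (hFE w hw) (hTE w hw) (hTE' w hw) (hne w hw)
  exact hev.frequently

/-! ## §3 The axis print — the letter `hsymm` -/

/-- **`hsymm`: `s(½ − it) = s(½ + it)` for every real `t`** (`1 − (½ + it) = ½ − it`). [cite: MoeglinWaldspurger1995, II.2.4] -/
theorem symbol_axis_symm {s : ℂ → ℂ} (hsymm : ∀ z : ℂ, s z = s (1 - z)) (t : ℝ) :
    s ((((1 / 2 : ℝ)) : ℂ) + ((-t : ℝ) : ℂ) * I) = s ((((1 / 2 : ℝ)) : ℂ) + t * I) := by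
  rw [hsymm ((((1 / 2 : ℝ)) : ℂ) + t * I)]
  congr 1
  push_cast
  ring

end Summit.HodgeConjecture.HodgeConjecture.Cruxes.H413.K2E1ChiSymbolWeylSymmetryM1CMTwo

end
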